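import Literature.MathematicalPhysics.KineticTheory.TaggedSphereGainSchur
import Literature.Analysis.FunctionSpaces.ContinuousKernelCompactOperator
import Mathlib.Analysis.InnerProductSpace.Dual
import HarnessLib

/-!
# The gain operator of the hard-sphere linear Boltzmann operator is compact on `L²(a_β M_β)`
(BGSR Lemma 6.1, the Hilbert–Grad compactness: Bodineau–Gallagher–Saint-Raymond, Invent. Math.
203 (2016) = arXiv:1305.3397v2 §6.1.2, "`L = a(v) Id - K` where `K` is a compact operator";
after Hilbert 1912 (BGSR's [24]) and Grad, cf. Cercignani–Illner–Pulvirenti 1994 §7.2)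

We realise BGSR's Hilbert space `L²(ℝ^d, a_β M_β dv)` as `Lp ℝ 2 (energyMeasure β)`,
`energyMeasure β = (a_β M_β) · Lebesgue` (a finite measure equivalent to Lebesgue measure), and
construct on it the bounded operators `T_χ` attached to the truncated gain forms
`Q_χ(g, h) = ∫∫ χ M_β k_β g(v + u) h(v)` of `TaggedSphereGainSchur` through the Riesz
representation (`InnerProductSpace.continuousLinearMapOfBilin`): `⟪T_χ g, h⟫ = Q_χ(g, h)`.
The *gain operator* `T = gainOp β` is the one of the full form `Q_1 = carlemanForm`, i.e.
`T = a_β⁻¹ K` read in `L²(a_β M_β)` (`⟪T g, h⟫_{aM} = ⟨K g, h⟩_{M}`), with `‖T‖ ≤ 1`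
(`sq_carlemanForm_le`).

## Main results

* `gainOp`, `inner_gainOp`, `norm_gainOp_le_one`.
* `gainOp_eq_add`: `T = T_reg + T_near + T_tail` for the cut-offs of `TaggedSphereGainSchur`.
* `isCompactOperator_truncOp_cutReg`: the regular part is compact — it acts as
  `(T_reg g)(v) = 1_{|v| ≤ R} ⟪κ(v), g⟫` with `v ↦ κ(v) ∈ L²(a_β M_β)` continuous
  (`continuous_regKernelLp`), so `ContinuousKernelCompactOperator` applies.
* `isCompactOperator_gainOp`: **`T` is compact** (BGSR Lemma 6.1, compactness half): the
  remainders have norms `≤ a₀⁻¹ ∫_{|u|<δ} G_β` and `≤ I_β (a₀ √(a₀ c R))^{-1/2}`-type bounds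
  (`sq_truncForm_le` with the row bounds of `TaggedSphereGainSchur`), which tend to `0`, and
  norm limits of compact operators are compact.

## References

* T. Bodineau, I. Gallagher, L. Saint-Raymond, *The Brownian motion as the limit of a
  deterministic system of hard-spheres*, Invent. Math. 203 (2016) 493–553 = arXiv:1305.3397v2,
  §6.1.2, Lemma 6.1.
* C. Cercignani, R. Illner, M. Pulvirenti, *The Mathematical Theory of Dilute Gases*, Springer
  (1994), §7.2.
-/

open MeasureTheory Metric Set Filter Topology ProbabilityTheory
open scoped InnerProductSpace ENNReal NNReal

noncomputable section

namespace Literature.MathematicalPhysics.KineticTheory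

open Literature.Analysis.FunctionSpaces (maxwellianBeta maxwellianBeta_pos)
open TaggedSphereDiffusion (collisionFrequency)

variable {d : Type*} [Fintype d] {β : ℝ}

/-! ## The Hilbert space `L²(a_β M_β)` -/

/-- The measure `a_β(v) M_β(v) dv` on `ℝ^d`; BGSR's Hilbert space of Lemma 6.1 is
`L²(ℝ^d, a_β M_β dv) = Lp ℝ 2 (energyMeasure β)`.
[cite: BodineauGallagherSaintRaymondInvent2016, Lemma 6.1] -/
def energyMeasure (β : ℝ) : Measure (EuclideanSpace ℝ d) :=
  volume.withDensity fun v => ENNReal.ofReal (collisionFrequency β v * maxwellianBeta β v)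

/-- The density of `energyMeasure` is measurable. [folklore] -/
theorem measurable_energyDensity (hβ : 0 < β) :
    Measurable fun v : EuclideanSpace ℝ d => ENNReal.ofReal (collisionFrequency β v * maxwellianBeta β v) :=
  (measurable_collisionFrequency_mul_maxwellianBeta hβ).ennreal_ofReal

/-- `energyMeasure` is a finite measure (`∫ a_β M_β < ∞`). [folklore] -/
theorem isFiniteMeasure_energyMeasure (hβ : 0 < β) : IsFiniteMeasure (energyMeasure (d := d) β) := by
  refine ⟨?_⟩
  rw [energyMeasure, withDensity_apply _ MeasurableSet.univ, Measure.restrict_univ]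
  exact lintegral_collisionFrequency_mul_maxwellianBeta_lt_top hβ

/-- `energyMeasure ≪ volume`. [folklore] -/
theorem energyMeasure_absolutelyContinuous (β : ℝ) :
    energyMeasure (d := d) β ≪ volume :=
  withDensity_absolutelyContinuous _ _

/-- `volume ≪ energyMeasure` (the density is positive). [folklore] -/
theorem absolutelyContinuous_energyMeasure (hd : 2 ≤ Fintype.card d) (hβ : 0 < β) :
    (volume : Measure (EuclideanSpace ℝ d)) ≪ energyMeasure β := by
  refine withDensity_absolutelyContinuous' (measurable_energyDensity hβ).aemeasurable
    (Eventually.of_forall fun v => ?_)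
  exact (ENNReal.ofReal_pos.2 (collisionFrequency_mul_maxwellianBeta_pos hd hβ v)).ne'

/-- A.e. statements for `energyMeasure` and for Lebesgue measure coincide. [folklore] -/
theorem ae_energyMeasure_iff (hd : 2 ≤ Fintype.card d) (hβ : 0 < β)
    {p : EuclideanSpace ℝ d → Prop} :
    (∀ᵐ v ∂energyMeasure β, p v) ↔ ∀ᵐ v ∂(volume : Measure (EuclideanSpace ℝ d)), p v :=
  ⟨fun h => (absolutelyContinuous_energyMeasure hd hβ).ae_le h,
    fun h => (energyMeasure_absolutelyContinuous β).ae_le h⟩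

/-- Integrals against `energyMeasure` are weighted Lebesgue integrals. [folklore] -/
theorem integral_energyMeasure (hβ : 0 < β) (f : EuclideanSpace ℝ d → ℝ) :
    ∫ v, f v ∂energyMeasure β = ∫ v, f v * (collisionFrequency β v * maxwellianBeta β v) := by
  rw [energyMeasure, integral_withDensity_eq_integral_toReal_smul (measurable_energyDensity hβ)
    (Eventually.of_forall fun v => ENNReal.ofReal_lt_top)]
  refine integral_congr_ae (Eventually.of_forall fun v => ?_)
  simp only [smul_eq_mul]
  rw [ENNReal.toReal_ofReal (mul_nonneg (TaggedLinearBoltzmannSeries.collisionFrequency_nonneg hβ v)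
    (maxwellianBeta_pos hβ v).le), mul_comm]

/-- Integrability against `energyMeasure`. [folklore] -/
theorem integrable_energyMeasure_iff (hβ : 0 < β) {f : EuclideanSpace ℝ d → ℝ} :
    Integrable f (energyMeasure β) ↔
      Integrable fun v => f v * (collisionFrequency β v * maxwellianBeta β v) := by
  rw [energyMeasure, integrable_withDensity_iff (measurable_energyDensity hβ)
    (Eventually.of_forall fun v => ENNReal.ofReal_lt_top)]
  refine integrable_congr (Eventually.of_forall fun v => ?_)
  simp only
  rw [ENNReal.toReal_ofReal (mul_nonneg (TaggedLinearBoltzmannSeries.collisionFrequency_nonneg hβ v)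
    (maxwellianBeta_pos hβ v).le)]

/-! ## Measurable representatives of finite energy -/

section Rep

variable (g h : Lp ℝ 2 (energyMeasure (d := d) β))

/-- A (strongly) measurable representative of an element of `L²(a_β M_β)`. [folklore] -/
def rep (g : Lp ℝ 2 (energyMeasure (d := d) β)) : EuclideanSpace ℝ d → ℝ :=
  (Lp.aestronglyMeasurable g).mk _

/-- `rep g` is measurable. [folklore] -/
@[fun_prop]
theorem measurable_rep : Measurable (rep g) :=
  (Lp.aestronglyMeasurable g).stronglyMeasurable_mk.measurable

/-- `rep g = g` a.e. for `energyMeasure`. [folklore] -/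
theorem rep_ae_eq : rep g =ᵐ[energyMeasure β] g :=
  (Lp.aestronglyMeasurable g).ae_eq_mk.symm

variable {g h}

/-- `rep g = g` a.e. for Lebesgue measure. [folklore] -/
theorem rep_ae_eq_volume (hd : 2 ≤ Fintype.card d) (hβ : 0 < β) (g : Lp ℝ 2 (energyMeasure (d := d) β)) :
    rep g =ᵐ[volume] g :=
  (ae_energyMeasure_iff hd hβ).1 (rep_ae_eq g)

/-- **Elements of `L²(a_β M_β)` have finite energy.** [folklore] -/
theorem finiteEnergy_rep (hβ : 0 < β) (g : Lp ℝ 2 (energyMeasure (d := d) β)) :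
    FiniteEnergy β (rep g) := by
  refine ⟨measurable_rep g, ?_⟩
  have hmem : MemLp (rep g) 2 (energyMeasure β) := (Lp.memLp g).ae_eq (rep_ae_eq g).symm
  have hint : Integrable (fun v => rep g v ^ 2) (energyMeasure β) :=
    (memLp_two_iff_integrable_sq hmem.1).1 hmem
  rw [integrable_energyMeasure_iff hβ] at hint
  exact hint.congr (Eventually.of_forall fun v => by ring)

/-- The inner product of `L²(a_β M_β)` through representatives. [folklore] -/
theorem inner_eq_integral_rep (hβ : 0 < β) (g h : Lp ℝ 2 (energyMeasure (d := d) β)) :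
    ⟪g, h⟫_ℝ = ∫ v, rep g v * rep h v * (collisionFrequency β v * maxwellianBeta β v) := by
  rw [L2.inner_def, ← integral_energyMeasure hβ]
  refine integral_congr_ae ?_
  filter_upwards [rep_ae_eq g, rep_ae_eq h] with v hg hh
  simp only [RCLike.inner_apply, conj_trivial]
  rw [hg, hh]
  ring

/-- The squared norm of `L²(a_β M_β)` is the energy of a representative. [folklore] -/
theorem norm_sq_eq_integral_rep (hβ : 0 < β) (g : Lp ℝ 2 (energyMeasure (d := d) β)) :
    ‖g‖ ^ 2 = ∫ v, rep g v ^ 2 * collisionFrequency β v * maxwellianBeta β v := by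
  rw [← real_inner_self_eq_norm_sq, inner_eq_integral_rep hβ]
  refine integral_congr_ae (Eventually.of_forall fun v => ?_)
  simp only
  ring

/-- Representatives add a.e. [folklore] -/
theorem rep_add_ae_eq (hd : 2 ≤ Fintype.card d) (hβ : 0 < β) (g h : Lp ℝ 2 (energyMeasure (d := d) β)) :
    rep (g + h) =ᵐ[volume] rep g + rep h := by
  refine (absolutelyContinuous_energyMeasure hd hβ).ae_le ?_
  show ∀ᵐ v ∂energyMeasure β, rep (g + h) v = (rep g + rep h) v
  filter_upwards [rep_ae_eq (g + h), rep_ae_eq g, rep_ae_eq h, Lp.coeFn_add g h] with v h1 h2 h3 h4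
  rw [h1, h4, Pi.add_apply, Pi.add_apply, h2, h3]

/-- Representatives scale a.e. [folklore] -/
theorem rep_smul_ae_eq (hd : 2 ≤ Fintype.card d) (hβ : 0 < β) (c : ℝ) (g : Lp ℝ 2 (energyMeasure (d := d) β)) :
    rep (c • g) =ᵐ[volume] c • rep g := by
  refine (absolutelyContinuous_energyMeasure hd hβ).ae_le ?_
  show ∀ᵐ v ∂energyMeasure β, rep (c • g) v = (c • rep g) v
  filter_upwards [rep_ae_eq (c • g), rep_ae_eq g, Lp.coeFn_smul c g] with v h1 h2 h3
  rw [h1, h3, Pi.smul_apply, Pi.smul_apply, h2]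

/-- The representative of `toLp f` is `f` a.e. [folklore] -/
theorem rep_toLp_ae_eq (hd : 2 ≤ Fintype.card d) (hβ : 0 < β) {f : EuclideanSpace ℝ d → ℝ}
    (hf : MemLp f 2 (energyMeasure (d := d) β)) : rep (hf.toLp f) =ᵐ[volume] f := by
  refine (absolutelyContinuous_energyMeasure hd hβ).ae_le ?_
  show ∀ᵐ v ∂energyMeasure β, rep (hf.toLp f) v = f v
  filter_upwards [rep_ae_eq (hf.toLp f), hf.coeFn_toLp] with v h1 h2
  rw [h1, h2]

end Rep

/-! ## The operators `T_χ` attached to the truncated gain forms -/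

section TruncOp

variable {χ : EuclideanSpace ℝ d × EuclideanSpace ℝ d → ℝ}

/-- The data attached to a cut-off `χ` making `Q_χ` a bounded form on `L²(a_β M_β)`: `χ` is a
cut-off and the rows of `χ` and of its reflection are bounded (`RowBound`). [folklore] -/
structure CutoffData (β : ℝ) (χ : EuclideanSpace ℝ d × EuclideanSpace ℝ d → ℝ) where
  /-- `χ` is a cut-off -/
  isCutoff : IsCutoff χ
  /-- the row bound of `χ` -/
  ρ : ℝ
  /-- the row bound of the reflected cut-off -/
  ρ' : ℝ
  ρ_nonneg : 0 ≤ ρ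
  ρ'_nonneg : 0 ≤ ρ'
  row : RowBound β χ ρ
  row' : RowBound β (reflectCutoff χ) ρ'

variable (hd : 2 ≤ Fintype.card d) (hβ : 0 < β) (D : CutoffData β χ)

/-- `Q_χ` read on `L²(a_β M_β)` through representatives. [folklore] -/
def truncFormLp (β : ℝ) (χ : EuclideanSpace ℝ d × EuclideanSpace ℝ d → ℝ)
    (g h : Lp ℝ 2 (energyMeasure (d := d) β)) : ℝ :=
  truncForm β χ (rep g) (rep h)

include hd hβ in
/-- **Boundedness of `Q_χ` on `L²(a_β M_β)`**: `|Q_χ(g, h)| ≤ √(ρ' ρ) ‖g‖ ‖h‖`. [folklore] -/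
theorem abs_truncFormLp_le (g h : Lp ℝ 2 (energyMeasure (d := d) β)) :
    |truncFormLp β χ g h| ≤ Real.sqrt (D.ρ' * D.ρ) * ‖g‖ * ‖h‖ := by
  have hsq := sq_truncForm_le hd hβ D.isCutoff D.ρ_nonneg D.ρ'_nonneg D.row D.row'
    (finiteEnergy_rep hβ g) (finiteEnergy_rep hβ h)
  rw [← norm_sq_eq_integral_rep hβ g, ← norm_sq_eq_integral_rep hβ h] at hsq
  have hle := Real.abs_le_sqrt hsq
  rw [truncFormLp]
  refine hle.trans (le_of_eq ?_)
  rw [show D.ρ' * ‖g‖ ^ 2 * (D.ρ * ‖h‖ ^ 2) = (D.ρ' * D.ρ) * (‖g‖ * ‖h‖) ^ 2 by ring,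
    Real.sqrt_mul (mul_nonneg D.ρ'_nonneg D.ρ_nonneg), Real.sqrt_sq (by positivity)]
  ring

include hd hβ in
/-- `Q_χ` is additive in `g` on `L²(a_β M_β)`. [folklore] -/
theorem truncFormLp_add_left (hχ : IsCutoff χ) (g g' h : Lp ℝ 2 (energyMeasure (d := d) β)) :
    truncFormLp β χ (g + g') h = truncFormLp β χ g h + truncFormLp β χ g' h := by
  simp only [truncFormLp]
  rw [truncForm_congr_ae β χ (rep_add_ae_eq hd hβ g g') EventuallyEq.rfl]
  exact truncForm_add_left hd hβ hχ (finiteEnergy_rep hβ g) (finiteEnergy_rep hβ g')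
    (finiteEnergy_rep hβ h)

include hd hβ in
/-- `Q_χ` is additive in `h` on `L²(a_β M_β)`. [folklore] -/
theorem truncFormLp_add_right (hχ : IsCutoff χ) (g h h' : Lp ℝ 2 (energyMeasure (d := d) β)) :
    truncFormLp β χ g (h + h') = truncFormLp β χ g h + truncFormLp β χ g h' := by
  simp only [truncFormLp]
  rw [truncForm_congr_ae β χ EventuallyEq.rfl (rep_add_ae_eq hd hβ h h')]
  exact truncForm_add_right hd hβ hχ (finiteEnergy_rep hβ g) (finiteEnergy_rep hβ h)
    (finiteEnergy_rep hβ h')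

include hd hβ in
/-- `Q_χ` is homogeneous in `g` on `L²(a_β M_β)`. [folklore] -/
theorem truncFormLp_smul_left (c : ℝ) (g h : Lp ℝ 2 (energyMeasure (d := d) β)) :
    truncFormLp β χ (c • g) h = c * truncFormLp β χ g h := by
  simp only [truncFormLp]
  rw [truncForm_congr_ae β χ (rep_smul_ae_eq hd hβ c g) EventuallyEq.rfl]
  exact truncForm_smul_left β χ c (rep g) (rep h)

include hd hβ in
/-- `Q_χ` is homogeneous in `h` on `L²(a_β M_β)`. [folklore] -/
theorem truncFormLp_smul_right (c : ℝ) (g h : Lp ℝ 2 (energyMeasure (d := d) β)) :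
    truncFormLp β χ g (c • h) = c * truncFormLp β χ g h := by
  simp only [truncFormLp]
  rw [truncForm_congr_ae β χ EventuallyEq.rfl (rep_smul_ae_eq hd hβ c h)]
  exact truncForm_smul_right β χ c (rep g) (rep h)

/-- **`Q_χ` as a continuous bilinear form on `L²(a_β M_β)`.** [folklore] -/
def truncBilin : Lp ℝ 2 (energyMeasure (d := d) β) →L[ℝ] Lp ℝ 2 (energyMeasure (d := d) β) →L[ℝ] ℝ :=
  LinearMap.mkContinuous₂
    (LinearMap.mk₂ ℝ (truncFormLp β χ) (truncFormLp_add_left hd hβ D.isCutoff) (truncFormLp_smul_left hd hβ)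
      (truncFormLp_add_right hd hβ D.isCutoff) (truncFormLp_smul_right hd hβ))
    (Real.sqrt (D.ρ' * D.ρ)) fun g h => by
      rw [Real.norm_eq_abs]
      exact abs_truncFormLp_le hd hβ D g h

/-- Evaluation of `truncBilin`. [folklore] -/
@[simp]
theorem truncBilin_apply (g h : Lp ℝ 2 (energyMeasure (d := d) β)) :
    truncBilin hd hβ D g h = truncForm β χ (rep g) (rep h) := rfl

/-- **The operator `T_χ`** on `L²(a_β M_β)` representing `Q_χ`: `⟪T_χ g, h⟫ = Q_χ(g, h)`
(Riesz representation). For `χ = 1` it is `a_β⁻¹ K` (`gainOp`).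
[cite: BodineauGallagherSaintRaymondInvent2016, §6.1.2 (`L = a(v) Id - K`)] -/
def truncOp : Lp ℝ 2 (energyMeasure (d := d) β) →L[ℝ] Lp ℝ 2 (energyMeasure (d := d) β) :=
  InnerProductSpace.continuousLinearMapOfBilin (𝕜 := ℝ) (truncBilin hd hβ D)

/-- `⟪T_χ g, h⟫ = Q_χ(g, h)`. [folklore] -/
theorem inner_truncOp (g h : Lp ℝ 2 (energyMeasure (d := d) β)) :
    ⟪truncOp hd hβ D g, h⟫_ℝ = truncForm β χ (rep g) (rep h) := by
  rw [truncOp, InnerProductSpace.continuousLinearMapOfBilin_apply, truncBilin_apply]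

/-- **Operator norm of `T_χ`**: `‖T_χ‖ ≤ √(ρ' ρ)`. [folklore] -/
theorem norm_truncOp_le : ‖truncOp hd hβ D‖ ≤ Real.sqrt (D.ρ' * D.ρ) := by
  refine ContinuousLinearMap.opNorm_le_bound _ (Real.sqrt_nonneg _) fun g => ?_
  have h := abs_truncFormLp_le hd hβ D g (truncOp hd hβ D g)
  rw [truncFormLp, ← inner_truncOp hd hβ D, real_inner_self_eq_norm_sq, abs_of_nonneg (sq_nonneg _)] at h
  by_cases h0 : ‖truncOp hd hβ D g‖ = 0
  · rw [h0]; positivity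
  · have hpos : 0 < ‖truncOp hd hβ D g‖ := (norm_nonneg _).lt_of_ne (Ne.symm h0)
    rw [sq] at h
    exact le_of_mul_le_mul_right h hpos

/-- Additivity of `T_χ` in the cut-off. [folklore] -/
theorem truncOp_add {χ₁ χ₂ : EuclideanSpace ℝ d × EuclideanSpace ℝ d → ℝ} (D₁ : CutoffData β χ₁)
    (D₂ : CutoffData β χ₂) (D : CutoffData β (χ₁ + χ₂)) :
    truncOp hd hβ D = truncOp hd hβ D₁ + truncOp hd hβ D₂ := by
  refine ContinuousLinearMap.ext fun g => ?_
  refine ext_inner_right ℝ fun h => ?_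
  rw [_root_.add_apply, inner_add_left, inner_truncOp, inner_truncOp, inner_truncOp]
  exact truncForm_add_cutoff hd hβ D₁.isCutoff D₂.isCutoff (finiteEnergy_rep hβ g)
    (finiteEnergy_rep hβ h)

end TruncOp

/-! ## The gain operator `T = a_β⁻¹ K` -/

section GainOp

variable (hd : 2 ≤ Fintype.card d) (hβ : 0 < β)

/-- `⟨K g, h⟩_{L²(M_β)}` read on `L²(a_β M_β)` through representatives. [folklore] -/
def gainFormLp (β : ℝ) (g h : Lp ℝ 2 (energyMeasure (d := d) β)) : ℝ :=
  carlemanForm β (rep g) (rep h)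

/-- `gainFormLp = truncFormLp 1`. [folklore] -/
theorem gainFormLp_eq (g h : Lp ℝ 2 (energyMeasure (d := d) β)) :
    gainFormLp β g h = truncFormLp β (fun _ => 1) g h := by
  rw [gainFormLp, truncFormLp, truncForm_one]

include hd hβ in
/-- **`|⟨K g, h⟩_{M}| ≤ ‖g‖_{aM} ‖h‖_{aM}`** (`sq_carlemanForm_le`). [folklore] -/
theorem abs_gainFormLp_le (g h : Lp ℝ 2 (energyMeasure (d := d) β)) :
    |gainFormLp β g h| ≤ 1 * ‖g‖ * ‖h‖ := by
  have hg := finiteEnergy_rep hβ g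
  have hh := finiteEnergy_rep hβ h
  have hsq := sq_carlemanForm_le hd hβ hg.measurable hg.integrable hh.measurable hh.integrable
  rw [← norm_sq_eq_integral_rep hβ g, ← norm_sq_eq_integral_rep hβ h, ← mul_pow] at hsq
  rw [gainFormLp, one_mul]
  have h := Real.abs_le_sqrt hsq
  rwa [Real.sqrt_sq (by positivity)] at h

include hd hβ in
/-- Additivity in `g`. [folklore] -/
theorem gainFormLp_add_left (g g' h : Lp ℝ 2 (energyMeasure (d := d) β)) :
    gainFormLp β (g + g') h = gainFormLp β g h + gainFormLp β g' h := by
  simp only [gainFormLp]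
  have hg := finiteEnergy_rep hβ g
  have hg' := finiteEnergy_rep hβ g'
  have hh := finiteEnergy_rep hβ h
  rw [← truncForm_one, ← truncForm_one, ← truncForm_one,
    truncForm_congr_ae β _ (rep_add_ae_eq hd hβ g g') EventuallyEq.rfl]
  exact truncForm_add_left hd hβ isCutoff_one hg hg' hh

include hd hβ in
/-- Additivity in `h`. [folklore] -/
theorem gainFormLp_add_right (g h h' : Lp ℝ 2 (energyMeasure (d := d) β)) :
    gainFormLp β g (h + h') = gainFormLp β g h + gainFormLp β g h' := by
  simp only [gainFormLp]
  rw [← truncForm_one, ← truncForm_one, ← truncForm_one,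
    truncForm_congr_ae β _ EventuallyEq.rfl (rep_add_ae_eq hd hβ h h')]
  exact truncForm_add_right hd hβ isCutoff_one (finiteEnergy_rep hβ g) (finiteEnergy_rep hβ h)
    (finiteEnergy_rep hβ h')

include hd hβ in
/-- Homogeneity in `g`. [folklore] -/
theorem gainFormLp_smul_left (c : ℝ) (g h : Lp ℝ 2 (energyMeasure (d := d) β)) :
    gainFormLp β (c • g) h = c * gainFormLp β g h := by
  simp only [gainFormLp]
  rw [← truncForm_one, ← truncForm_one, truncForm_congr_ae β _ (rep_smul_ae_eq hd hβ c g) EventuallyEq.rfl]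
  exact truncForm_smul_left β _ c (rep g) (rep h)

include hd hβ in
/-- Homogeneity in `h`. [folklore] -/
theorem gainFormLp_smul_right (c : ℝ) (g h : Lp ℝ 2 (energyMeasure (d := d) β)) :
    gainFormLp β g (c • h) = c * gainFormLp β g h := by
  simp only [gainFormLp]
  rw [← truncForm_one, ← truncForm_one, truncForm_congr_ae β _ EventuallyEq.rfl (rep_smul_ae_eq hd hβ c h)]
  exact truncForm_smul_right β _ c (rep g) (rep h)

/-- `⟨K g, h⟩_{M}` as a continuous bilinear form on `L²(a_β M_β)`, with bound `1`. [folklore] -/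
def gainBilin : Lp ℝ 2 (energyMeasure (d := d) β) →L[ℝ] Lp ℝ 2 (energyMeasure (d := d) β) →L[ℝ] ℝ :=
  LinearMap.mkContinuous₂
    (LinearMap.mk₂ ℝ (gainFormLp β) (gainFormLp_add_left hd hβ) (gainFormLp_smul_left hd hβ)
      (gainFormLp_add_right hd hβ) (gainFormLp_smul_right hd hβ))
    1 fun g h => by
      rw [Real.norm_eq_abs]
      exact abs_gainFormLp_le hd hβ g h

/-- Evaluation of `gainBilin`. [folklore] -/
@[simp]
theorem gainBilin_apply (g h : Lp ℝ 2 (energyMeasure (d := d) β)) :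
    gainBilin hd hβ g h = carlemanForm β (rep g) (rep h) := rfl

/-- **The gain operator `T = a_β⁻¹ K` on `L²(a_β M_β)`** (so that `L = a_β (Id - T)`):
the bounded operator with `⟪T g, h⟫_{L²(aM)} = ⟨K g, h⟩_{L²(M)} = ∫∫ M_β k_β g(v + u) h(v)`.
[cite: BodineauGallagherSaintRaymondInvent2016, Lemma 6.1 (`L = a(v) Id - K`)] -/
def gainOp : Lp ℝ 2 (energyMeasure (d := d) β) →L[ℝ] Lp ℝ 2 (energyMeasure (d := d) β) :=
  InnerProductSpace.continuousLinearMapOfBilin (𝕜 := ℝ) (gainBilin hd hβ)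

/-- `⟪T g, h⟫ = ⟨K g, h⟩_{L²(M_β)}`. [folklore] -/
theorem inner_gainOp (g h : Lp ℝ 2 (energyMeasure (d := d) β)) :
    ⟪gainOp hd hβ g, h⟫_ℝ = carlemanForm β (rep g) (rep h) := by
  rw [gainOp, InnerProductSpace.continuousLinearMapOfBilin_apply, gainBilin_apply]

/-- **`‖T‖ ≤ 1`.** [folklore] -/
theorem norm_gainOp_le_one : ‖gainOp hd hβ‖ ≤ 1 := by
  refine ContinuousLinearMap.opNorm_le_bound _ zero_le_one fun g => ?_
  have h := abs_gainFormLp_le hd hβ g (gainOp hd hβ g)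
  rw [gainFormLp, ← inner_gainOp hd hβ, real_inner_self_eq_norm_sq, abs_of_nonneg (sq_nonneg _),
    one_mul] at h
  by_cases h0 : ‖gainOp hd hβ g‖ = 0
  · rw [h0]; positivity
  · have hpos : 0 < ‖gainOp hd hβ g‖ := (norm_nonneg _).lt_of_ne (Ne.symm h0)
    rw [sq] at h
    rw [one_mul]
    exact le_of_mul_le_mul_right h hpos

/-- **`T = T_reg + T_near + T_tail`** for the cut-offs of `TaggedSphereGainSchur`. [folklore] -/
theorem gainOp_eq_add {δ R : ℝ} (Dreg : CutoffData β (cutReg (d := d) δ R))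
    (Dnear : CutoffData β (cutNear (d := d) δ R)) (Dtail : CutoffData β (cutTail (d := d) R)) :
    gainOp hd hβ = truncOp hd hβ Dreg + truncOp hd hβ Dnear + truncOp hd hβ Dtail := by
  refine ContinuousLinearMap.ext fun g => ?_
  refine ext_inner_right ℝ fun h => ?_
  have hg := finiteEnergy_rep hβ g
  have hh := finiteEnergy_rep hβ h
  rw [_root_.add_apply, _root_.add_apply, inner_add_left, inner_add_left,
    inner_truncOp, inner_truncOp, inner_truncOp, inner_gainOp, ← truncForm_one,
    ← truncForm_add_cutoff hd hβ (isCutoff_cutReg δ R) (isCutoff_cutNear δ R) hg hh,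
    ← truncForm_add_cutoff hd hβ ?_ (isCutoff_cutTail R) hg hh]
  · congr 1
    funext z
    simp only [Pi.add_apply, cutReg_add_cutNear_add_cutTail]
  · -- `χ_reg + χ_near = 1_{|v| ≤ R}` is a cut-off
    refine ⟨(isCutoff_cutReg δ R).measurable.add (isCutoff_cutNear δ R).measurable, fun z => ?_,
      fun z => ?_⟩
    · exact add_nonneg ((isCutoff_cutReg δ R).nonneg z) ((isCutoff_cutNear δ R).nonneg z)
    · have h1 := cutReg_add_cutNear_add_cutTail δ R z
      have h2 := (isCutoff_cutTail R).nonneg z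
      simp only [Pi.add_apply]
      linarith

end GainOp

/-! ## The regular part is compact -/

section Regular

variable {δ : ℝ}

/-- The one-dimensional Gaussian density is continuous. [folklore] -/
theorem continuous_gaussianPDFReal' (m : ℝ) (v : ℝ≥0) : Continuous (gaussianPDFReal m v) := by
  rw [gaussianPDFReal_def]
  fun_prop

/-- The one-dimensional Gaussian density is bounded by its prefactor. [folklore] -/
theorem gaussianPDFReal_le (m : ℝ) (v : ℝ≥0) (x : ℝ) : gaussianPDFReal m v x ≤ (Real.sqrt (2 * Real.pi * v))⁻¹ := by
  rw [gaussianPDFReal_def]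
  simp only
  refine mul_le_of_le_one_right (inv_nonneg.2 (Real.sqrt_nonneg _)) ?_
  rw [Real.exp_le_one_iff, neg_div]
  exact neg_nonpos.2 (div_nonneg (sq_nonneg _) (by positivity))

/-- The Carleman kernel is continuous away from `u = 0`. [folklore] -/
theorem continuousOn_carlemanKernel (β : ℝ) :
    ContinuousOn (fun p : EuclideanSpace ℝ d × EuclideanSpace ℝ d => carlemanKernel β p.1 p.2)
      {p | p.2 ≠ 0} := by
  intro p hp
  have hp' : ‖p.2‖ ≠ 0 := norm_ne_zero_iff.2 hp
  refine ContinuousAt.continuousWithinAt ?_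
  unfold carlemanKernel
  refine ContinuousAt.mul ?_ ?_
  · exact (continuousAt_snd.norm.pow _).inv₀ (pow_ne_zero _ hp')
  · refine (continuous_gaussianPDFReal' 0 _).continuousAt.comp ?_
    exact continuousAt_snd.norm.add ((continuousAt_fst.inner continuousAt_snd).div
      continuousAt_snd.norm hp')

/-- The regularised kernel `θ_δ(u) k_β(v, u)` (the Carleman kernel with `u` cut away from `0`).
[folklore] -/
def regKernel (δ β : ℝ) (v u : EuclideanSpace ℝ d) : ℝ := bump δ u * carlemanKernel β v u

/-- **The regularised kernel is jointly continuous** (`δ > 0`): continuous where `u ≠ 0`, and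
identically `0` near `u = 0`. [folklore] -/
theorem continuous_regKernel (hδ : 0 < δ) (β : ℝ) :
    Continuous fun p : EuclideanSpace ℝ d × EuclideanSpace ℝ d => regKernel δ β p.1 p.2 := by
  unfold regKernel
  refine continuous_iff_continuousAt.2 fun p => ?_
  by_cases hp : p.2 = 0
  · -- identically zero near `p`
    have hev : (fun _ : EuclideanSpace ℝ d × EuclideanSpace ℝ d => (0 : ℝ)) =ᶠ[𝓝 p]
        fun q => bump δ q.2 * carlemanKernel β q.1 q.2 := by
      have hopen : IsOpen {q : EuclideanSpace ℝ d × EuclideanSpace ℝ d | ‖q.2‖ < δ / 2} :=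
        isOpen_lt continuous_snd.norm continuous_const
      have hmem : p ∈ {q : EuclideanSpace ℝ d × EuclideanSpace ℝ d | ‖q.2‖ < δ / 2} := by
        simp only [mem_setOf_eq, hp, norm_zero]; positivity
      filter_upwards [hopen.mem_nhds hmem] with q hq
      rw [bump_eq_zero hδ (le_of_lt hq), zero_mul]
    exact continuousAt_const.congr hev
  · exact ((continuous_bump δ).continuousAt.comp continuousAt_snd).mul
      ((continuousOn_carlemanKernel β).continuousAt ((isOpen_ne_fun continuous_snd
        continuous_const).mem_nhds hp))

/-- `θ_δ(u) G_β(u) ≤ C_δ e^{-β|u|²/8}` with `C_δ = (2π/β)^{-1/2} ((δ/2)^{d-2})⁻¹`: the cut-off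
removes the singularity of `G_β` at the origin. [folklore] -/
theorem bump_mul_gradRadial_le (hδ : 0 < δ) (β : ℝ) (u : EuclideanSpace ℝ d) :
    bump δ u * gradRadial β u ≤ (Real.sqrt (2 * Real.pi * β⁻¹))⁻¹ * ((δ / 2) ^ (Fintype.card d - 2))⁻¹ *
      Real.exp (-(β / 8) * ‖u‖ ^ 2) := by
  by_cases hu : ‖u‖ ≤ δ / 2
  · rw [bump_eq_zero hδ hu, zero_mul]
    positivity
  · rw [not_le] at hu
    calc bump δ u * gradRadial β u ≤ 1 * gradRadial β u :=
          mul_le_mul_of_nonneg_right (bump_le_one δ u) (gradRadial_nonneg β u)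
      _ ≤ _ := by
          rw [one_mul, gradRadial]
          refine mul_le_mul_of_nonneg_right (mul_le_mul_of_nonneg_left ?_
            (inv_nonneg.2 (Real.sqrt_nonneg _))) (Real.exp_nonneg _)
          exact inv_anti₀ (pow_pos (by positivity) _) (pow_le_pow_left₀ (by positivity) hu.le _)

/-- The regular kernel of `T_reg` as a function of `v'`:
`κ_v(v') = θ_δ(v' - v) k_β(v, v' - v) / (a_β(v) a_β(v') M_β(v'))`, so that
`⟪κ_v, g⟫_{L²(aM)} = a_β(v)⁻¹ ∫ θ_δ(u) k_β(v, u) g(v + u) du`. [folklore] -/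
def regKernelFun (δ β : ℝ) (v : EuclideanSpace ℝ d) : EuclideanSpace ℝ d → ℝ := fun v' =>
  regKernel δ β v (v' - v) / (collisionFrequency β v * (collisionFrequency β v' * maxwellianBeta β v'))

/-- `k_β(v, u)² / M_β(v + u) ≤ G_β(u)² / M_β(v)` (square of Grad's bound). [folklore] -/
theorem carlemanKernel_sq_div_le (hβ : 0 < β) (v u : EuclideanSpace ℝ d) :
    carlemanKernel β v u ^ 2 / maxwellianBeta β (v + u) ≤ gradRadial β u ^ 2 / maxwellianBeta β v := by
  have hM := maxwellianBeta_pos hβ v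
  have hM' := maxwellianBeta_pos hβ (v + u)
  have h := maxwellianBeta_mul_carlemanKernel_le hβ v u
  have h' : maxwellianBeta β v * carlemanKernel β v u ≤
      gradRadial β u * Real.sqrt (maxwellianBeta β v * maxwellianBeta β (v + u)) := by
    simpa [gradRadial, mul_assoc, mul_comm, mul_left_comm] using h
  have h0 : 0 ≤ maxwellianBeta β v * carlemanKernel β v u := mul_nonneg hM.le (carlemanKernel_nonneg β v u)
  have hsq := pow_le_pow_left₀ h0 h' 2
  rw [mul_pow, mul_pow, Real.sq_sqrt (mul_nonneg hM.le hM'.le)] at hsq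
  rw [div_le_div_iff₀ hM' hM]
  refine le_of_mul_le_mul_left ?_ hM
  calc maxwellianBeta β v * (carlemanKernel β v u ^ 2 * maxwellianBeta β v)
      = maxwellianBeta β v ^ 2 * carlemanKernel β v u ^ 2 := by ring
    _ ≤ gradRadial β u ^ 2 * (maxwellianBeta β v * maxwellianBeta β (v + u)) := hsq
    _ = maxwellianBeta β v * (gradRadial β u ^ 2 * maxwellianBeta β (v + u)) := by ring

variable (hd : 2 ≤ Fintype.card d) (hβ : 0 < β)

include hβ in
/-- **Gaussian domination of the regular kernel**: for `|v| ≤ r`,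
`κ_v(v')² a_β(v') M_β(v') ≤ C e^{-β|v'|²/8}` with `C = C(δ, β, r, a₀)`. [folklore] -/
theorem regKernelFun_sq_mul_le (hδ : 0 < δ) {a₀ : ℝ} (ha₀ : 0 < a₀)
    (hlow : ∀ w : EuclideanSpace ℝ d, a₀ ≤ collisionFrequency β w) {r : ℝ} {v : EuclideanSpace ℝ d} (hv : ‖v‖ ≤ r)
    (v' : EuclideanSpace ℝ d) :
    regKernelFun δ β v v' ^ 2 * (collisionFrequency β v' * maxwellianBeta β v') ≤
      ((Real.sqrt (2 * Real.pi * β⁻¹))⁻¹ * ((δ / 2) ^ (Fintype.card d - 2))⁻¹) ^ 2 *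
        (a₀ ^ 3)⁻¹ * ((2 * Real.pi * β⁻¹) ^ (-(Module.finrank ℝ (EuclideanSpace ℝ d) : ℝ) / 2))⁻¹ *
        Real.exp ((β / 2) * r ^ 2) * Real.exp ((β / 4) * r ^ 2) * Real.exp (-(β / 8) * ‖v'‖ ^ 2) := by
  set u := v' - v with hu
  have hv' : v' = v + u := by rw [hu]; abel
  set Cδ := (Real.sqrt (2 * Real.pi * β⁻¹))⁻¹ * ((δ / 2) ^ (Fintype.card d - 2))⁻¹ with hCδ
  set A := (2 * Real.pi * β⁻¹) ^ (-(Module.finrank ℝ (EuclideanSpace ℝ d) : ℝ) / 2) with hA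
  have hApos : 0 < A := Real.rpow_pos_of_pos (by positivity) _
  have ha : ∀ w : EuclideanSpace ℝ d, 0 < collisionFrequency β w := fun w => ha₀.trans_le (hlow w)
  have hM : ∀ w : EuclideanSpace ℝ d, 0 < maxwellianBeta β w := maxwellianBeta_pos hβ
  have hCδ0 : 0 ≤ Cδ := by positivity
  -- the kernel part
  have hk : regKernel δ β v u ^ 2 / maxwellianBeta β (v + u) ≤ Cδ ^ 2 *
      Real.exp (-(β / 4) * ‖u‖ ^ 2) / maxwellianBeta β v := by
    rw [regKernel, mul_pow, mul_div_assoc]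
    calc bump δ u ^ 2 * (carlemanKernel β v u ^ 2 / maxwellianBeta β (v + u))
        ≤ bump δ u ^ 2 * (gradRadial β u ^ 2 / maxwellianBeta β v) :=
          mul_le_mul_of_nonneg_left (carlemanKernel_sq_div_le hβ v u) (sq_nonneg _)
      _ = (bump δ u * gradRadial β u) ^ 2 / maxwellianBeta β v := by ring
      _ ≤ (Cδ * Real.exp (-(β / 8) * ‖u‖ ^ 2)) ^ 2 / maxwellianBeta β v := by
          refine div_le_div_of_nonneg_right (pow_le_pow_left₀ (mul_nonneg (bump_nonneg δ u)
            (gradRadial_nonneg β u)) (bump_mul_gradRadial_le hδ β u) 2) (hM v).le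
      _ = Cδ ^ 2 * Real.exp (-(β / 4) * ‖u‖ ^ 2) / maxwellianBeta β v := by
          rw [mul_pow, ← Real.exp_nat_mul,
            show ((2 : ℕ) : ℝ) * (-(β / 8) * ‖u‖ ^ 2) = -(β / 4) * ‖u‖ ^ 2 by push_cast; ring]
  -- `1 / M_β(v) ≤ A⁻¹ e^{β r²/2}`
  have hMinv : (maxwellianBeta β v)⁻¹ ≤ A⁻¹ * Real.exp ((β / 2) * r ^ 2) := by
    rw [KineticTheory.maxwellianBeta_eq, ← hA, mul_inv, ← Real.exp_neg]
    refine mul_le_mul_of_nonneg_left (Real.exp_le_exp.2 ?_) (inv_nonneg.2 hApos.le)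
    have : ‖v‖ ^ 2 ≤ r ^ 2 := pow_le_pow_left₀ (norm_nonneg _) hv 2
    nlinarith
  -- `e^{-β|u|²/4} ≤ e^{βr²/4} e^{-β|v'|²/8}`
  have hexp : Real.exp (-(β / 4) * ‖u‖ ^ 2) ≤ Real.exp ((β / 4) * r ^ 2) * Real.exp (-(β / 8) * ‖v'‖ ^ 2) := by
    rw [← Real.exp_add, Real.exp_le_exp]
    have h1 : ‖v'‖ ≤ ‖v‖ + ‖u‖ := by rw [hv']; exact norm_add_le v u
    have h2 : ‖v'‖ ^ 2 ≤ 2 * ‖v‖ ^ 2 + 2 * ‖u‖ ^ 2 := by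
      nlinarith [h1, norm_nonneg v, norm_nonneg u, norm_nonneg v', sq_nonneg (‖v‖ - ‖u‖)]
    have h3 : ‖v‖ ^ 2 ≤ r ^ 2 := pow_le_pow_left₀ (norm_nonneg _) hv 2
    nlinarith [mul_le_mul_of_nonneg_left h2 hβ.le, mul_le_mul_of_nonneg_left h3 hβ.le]
  -- assemble
  have hav := ha v
  have hav' := ha v'
  have hMv := hM v
  have hMv' := hM v'
  have hmain : regKernelFun δ β v v' ^ 2 * (collisionFrequency β v' * maxwellianBeta β v') =
      regKernel δ β v u ^ 2 / maxwellianBeta β (v + u) *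
        (collisionFrequency β v ^ 2 * collisionFrequency β v')⁻¹ := by
    simp only [regKernelFun]
    rw [← hu, ← hv']
    have h1 : collisionFrequency β v ≠ 0 := hav.ne'
    have h2 : collisionFrequency β v' ≠ 0 := hav'.ne'
    have h3 : maxwellianBeta β v' ≠ 0 := hMv'.ne'
    field_simp
  have hfrac : (collisionFrequency β v ^ 2 * collisionFrequency β v')⁻¹ ≤ (a₀ ^ 3)⁻¹ := by
    refine inv_anti₀ (by positivity) ?_
    calc a₀ ^ 3 = a₀ ^ 2 * a₀ := by ring
      _ ≤ collisionFrequency β v ^ 2 * collisionFrequency β v' :=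
          mul_le_mul (pow_le_pow_left₀ ha₀.le (hlow v) 2) (hlow v') ha₀.le (sq_nonneg _)
  rw [hmain]
  have hk0 : 0 ≤ Cδ ^ 2 * Real.exp (-(β / 4) * ‖u‖ ^ 2) / maxwellianBeta β v :=
    div_nonneg (mul_nonneg (sq_nonneg _) (Real.exp_nonneg _)) hMv.le
  calc regKernel δ β v u ^ 2 / maxwellianBeta β (v + u) *
        (collisionFrequency β v ^ 2 * collisionFrequency β v')⁻¹
      ≤ (Cδ ^ 2 * Real.exp (-(β / 4) * ‖u‖ ^ 2) / maxwellianBeta β v) * (a₀ ^ 3)⁻¹ :=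
        mul_le_mul hk hfrac (inv_nonneg.2 (mul_nonneg (sq_nonneg _) hav'.le)) hk0
    _ = Cδ ^ 2 * (a₀ ^ 3)⁻¹ * (maxwellianBeta β v)⁻¹ * Real.exp (-(β / 4) * ‖u‖ ^ 2) := by ring
    _ ≤ Cδ ^ 2 * (a₀ ^ 3)⁻¹ * (A⁻¹ * Real.exp ((β / 2) * r ^ 2)) *
          (Real.exp ((β / 4) * r ^ 2) * Real.exp (-(β / 8) * ‖v'‖ ^ 2)) :=
        mul_le_mul (mul_le_mul_of_nonneg_left hMinv (by positivity)) hexp (Real.exp_nonneg _)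
          (by positivity)
    _ = _ := by ring

end Regular

/-! ## The regular kernel as a continuous map into `L²(a_β M_β)` -/

section RegularLp

variable (hd : 2 ≤ Fintype.card d) (hβ : 0 < β) {δ : ℝ} (hδ : 0 < δ)

include hd hβ hδ

omit hδ in
/-- The denominator `a_β(v) a_β(v') M_β(v')` of `κ_v` never vanishes. [folklore] -/
theorem regKernelFun_den_ne_zero (v v' : EuclideanSpace ℝ d) :
    collisionFrequency β v * (collisionFrequency β v' * maxwellianBeta β v') ≠ 0 := by
  obtain ⟨a₀, ha₀, c, hc, hlow⟩ := exists_collisionFrequency_lowerBound (d := d) hd hβ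
  have ha : ∀ w : EuclideanSpace ℝ d, collisionFrequency β w ≠ 0 := fun w => (ha₀.trans_le (hlow w).1).ne'
  exact mul_ne_zero (ha v) (mul_ne_zero (ha v') (maxwellianBeta_pos hβ v').ne')

/-- `κ_v` is continuous in `v'`. [folklore] -/
theorem continuous_regKernelFun (v : EuclideanSpace ℝ d) : Continuous (regKernelFun δ β v) := by
  have hnum : Continuous fun v' : EuclideanSpace ℝ d => regKernel δ β v (v' - v) :=
    (continuous_regKernel hδ β).comp (f := fun v' : EuclideanSpace ℝ d => (v, v' - v))
      (continuous_const.prodMk (continuous_id.sub continuous_const))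
  have hden : Continuous fun v' : EuclideanSpace ℝ d =>
      collisionFrequency β v * (collisionFrequency β v' * maxwellianBeta β v') :=
    continuous_const.mul ((continuous_collisionFrequency hβ).mul (KineticTheory.continuous_maxwellianBeta β))
  exact hnum.div hden (regKernelFun_den_ne_zero hd hβ v)

omit hδ in
/-- `κ_v` is jointly continuous in `(v, v')`. [folklore] -/
theorem continuous_regKernelFun_uncurry (hδ : 0 < δ) :
    Continuous fun p : EuclideanSpace ℝ d × EuclideanSpace ℝ d => regKernelFun δ β p.1 p.2 := by
  have hnum : Continuous fun p : EuclideanSpace ℝ d × EuclideanSpace ℝ d => regKernel δ β p.1 (p.2 - p.1) :=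
    (continuous_regKernel hδ β).comp
      (f := fun p : EuclideanSpace ℝ d × EuclideanSpace ℝ d => (p.1, p.2 - p.1))
      (continuous_fst.prodMk (continuous_snd.sub continuous_fst))
  have hden : Continuous fun p : EuclideanSpace ℝ d × EuclideanSpace ℝ d =>
      collisionFrequency β p.1 * (collisionFrequency β p.2 * maxwellianBeta β p.2) :=
    ((continuous_collisionFrequency hβ).comp continuous_fst).mul
      (((continuous_collisionFrequency hβ).comp continuous_snd).mul
        ((KineticTheory.continuous_maxwellianBeta β).comp continuous_snd))
  exact hnum.div hden fun p => regKernelFun_den_ne_zero hd hβ p.1 p.2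

/-- An explicit Gaussian dominating `κ_v² a_β M_β` locally uniformly in `v` (`|v| ≤ r`).
[folklore] -/
theorem exists_gaussian_bound_regKernelFun (r : ℝ) :
    ∃ C : ℝ, 0 ≤ C ∧ ∀ v : EuclideanSpace ℝ d, ‖v‖ ≤ r → ∀ v' : EuclideanSpace ℝ d,
      regKernelFun δ β v v' ^ 2 * (collisionFrequency β v' * maxwellianBeta β v') ≤
        C * Real.exp (-(β / 8) * ‖v'‖ ^ 2) := by
  obtain ⟨a₀, ha₀, c, hc, hlow⟩ := exists_collisionFrequency_lowerBound (d := d) hd hβ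
  refine ⟨((Real.sqrt (2 * Real.pi * β⁻¹))⁻¹ * ((δ / 2) ^ (Fintype.card d - 2))⁻¹) ^ 2 *
      (a₀ ^ 3)⁻¹ * ((2 * Real.pi * β⁻¹) ^ (-(Module.finrank ℝ (EuclideanSpace ℝ d) : ℝ) / 2))⁻¹ *
      Real.exp ((β / 2) * r ^ 2) * Real.exp ((β / 4) * r ^ 2), ?_, fun v hv v' => ?_⟩
  · have hA : 0 < (2 * Real.pi * β⁻¹) ^ (-(Module.finrank ℝ (EuclideanSpace ℝ d) : ℝ) / 2) :=
      Real.rpow_pos_of_pos (by positivity) _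
    positivity
  · exact regKernelFun_sq_mul_le hβ hδ ha₀ (fun w => (hlow w).1) hv v'

/-- **`κ_v ∈ L²(a_β M_β)`.** [folklore] -/
theorem memLp_regKernelFun (v : EuclideanSpace ℝ d) : MemLp (regKernelFun δ β v) 2 (energyMeasure β) := by
  obtain ⟨C, hC, hbound⟩ := exists_gaussian_bound_regKernelFun hd hβ hδ ‖v‖
  have hcont := continuous_regKernelFun hd hβ hδ v
  rw [memLp_two_iff_integrable_sq hcont.aestronglyMeasurable, integrable_energyMeasure_iff hβ]
  have hgauss : Integrable fun v' : EuclideanSpace ℝ d => C * Real.exp (-(β / 8) * ‖v'‖ ^ 2) :=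
    (Literature.Analysis.FluidPDE.integrable_exp_neg_mul_sq_norm (E := EuclideanSpace ℝ d)
      (by positivity : 0 < β / 8)).const_mul C
  refine hgauss.mono' ((hcont.pow 2).mul ((continuous_collisionFrequency hβ).mul
    (KineticTheory.continuous_maxwellianBeta β))).aestronglyMeasurable (Eventually.of_forall fun v' => ?_)
  rw [Real.norm_of_nonneg (mul_nonneg (sq_nonneg _) (mul_nonneg
    (TaggedLinearBoltzmannSeries.collisionFrequency_nonneg hβ v') (maxwellianBeta_pos hβ v').le))]
  exact hbound v le_rfl v'

/-- **The regular kernel as a map into `L²(a_β M_β)`**: `v ↦ κ_v`. [folklore] -/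
def regKernelLp (v : EuclideanSpace ℝ d) : Lp ℝ 2 (energyMeasure (d := d) β) :=
  (memLp_regKernelFun hd hβ hδ v).toLp _

/-- The squared distance of two regular kernels in `L²(a_β M_β)` is the weighted integral of the
squared difference. [folklore] -/
theorem norm_regKernelLp_sub_sq (v w : EuclideanSpace ℝ d) :
    ‖regKernelLp hd hβ hδ v - regKernelLp hd hβ hδ w‖ ^ 2 =
      ∫ v', (regKernelFun δ β v v' - regKernelFun δ β w v') ^ 2 *
        (collisionFrequency β v' * maxwellianBeta β v') := by
  have hsub : regKernelLp hd hβ hδ v - regKernelLp hd hβ hδ w =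
      ((memLp_regKernelFun hd hβ hδ v).sub (memLp_regKernelFun hd hβ hδ w)).toLp
        (regKernelFun δ β v - regKernelFun δ β w) := by
    rw [regKernelLp, regKernelLp, MemLp.toLp_sub]
  rw [hsub, norm_sq_eq_integral_rep hβ]
  refine integral_congr_ae ?_
  filter_upwards [rep_toLp_ae_eq hd hβ ((memLp_regKernelFun hd hβ hδ v).sub
    (memLp_regKernelFun hd hβ hδ w))] with v' hv'
  rw [hv', Pi.sub_apply, mul_assoc]

/-- **`v ↦ κ_v` is continuous into `L²(a_β M_β)`** (dominated convergence with the Gaussian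
bound, and continuity of `κ_v(v')` in `v`). [folklore] -/
theorem continuous_regKernelLp : Continuous (regKernelLp (d := d) hd hβ hδ) := by
  refine continuous_iff_continuousAt.2 fun v₀ => ?_
  rw [ContinuousAt, tendsto_iff_norm_sub_tendsto_zero]
  obtain ⟨C, hC, hbound⟩ := exists_gaussian_bound_regKernelFun hd hβ hδ (‖v₀‖ + 1)
  set F : EuclideanSpace ℝ d → EuclideanSpace ℝ d → ℝ := fun v v' =>
    (regKernelFun δ β v v' - regKernelFun δ β v₀ v') ^ 2 *
      (collisionFrequency β v' * maxwellianBeta β v') with hF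
  have hgauss : Integrable fun v' : EuclideanSpace ℝ d => 4 * C * Real.exp (-(β / 8) * ‖v'‖ ^ 2) :=
    (Literature.Analysis.FluidPDE.integrable_exp_neg_mul_sq_norm (E := EuclideanSpace ℝ d)
      (by positivity : 0 < β / 8)).const_mul (4 * C)
  have hmeas : ∀ v, AEStronglyMeasurable (F v) volume := fun v =>
    ((((continuous_regKernelFun hd hβ hδ v).sub (continuous_regKernelFun hd hβ hδ v₀)).pow 2).mul
      ((continuous_collisionFrequency hβ).mul (KineticTheory.continuous_maxwellianBeta β))).aestronglyMeasurable
  have hball : ∀ᶠ v in 𝓝 v₀, ‖v‖ ≤ ‖v₀‖ + 1 := by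
    filter_upwards [Metric.ball_mem_nhds v₀ one_pos] with v hv
    have := norm_sub_norm_le v v₀
    rw [mem_ball, dist_eq_norm] at hv
    linarith
  have hlim : Tendsto (fun v => ∫ v', F v v') (𝓝 v₀) (𝓝 (∫ _ : EuclideanSpace ℝ d, (0 : ℝ))) := by
    refine tendsto_integral_filter_of_dominated_convergence (fun v' => 4 * C * Real.exp (-(β / 8) * ‖v'‖ ^ 2))
      (Eventually.of_forall hmeas) ?_ hgauss ?_
    · filter_upwards [hball] with v hv
      refine Eventually.of_forall fun v' => ?_
      have h1 := hbound v hv v'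
      have h2 := hbound v₀ (by linarith) v'
      have hw : 0 ≤ collisionFrequency β v' * maxwellianBeta β v' :=
        mul_nonneg (TaggedLinearBoltzmannSeries.collisionFrequency_nonneg hβ v') (maxwellianBeta_pos hβ v').le
      rw [Real.norm_of_nonneg (mul_nonneg (sq_nonneg _) hw)]
      have hsq : (regKernelFun δ β v v' - regKernelFun δ β v₀ v') ^ 2 ≤
          2 * regKernelFun δ β v v' ^ 2 + 2 * regKernelFun δ β v₀ v' ^ 2 := by
        nlinarith [sq_nonneg (regKernelFun δ β v v' + regKernelFun δ β v₀ v')]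
      calc (regKernelFun δ β v v' - regKernelFun δ β v₀ v') ^ 2 *
            (collisionFrequency β v' * maxwellianBeta β v')
          ≤ (2 * regKernelFun δ β v v' ^ 2 + 2 * regKernelFun δ β v₀ v' ^ 2) *
            (collisionFrequency β v' * maxwellianBeta β v') := mul_le_mul_of_nonneg_right hsq hw
        _ = 2 * (regKernelFun δ β v v' ^ 2 * (collisionFrequency β v' * maxwellianBeta β v')) +
            2 * (regKernelFun δ β v₀ v' ^ 2 * (collisionFrequency β v' * maxwellianBeta β v')) := by ring
        _ ≤ 2 * (C * Real.exp (-(β / 8) * ‖v'‖ ^ 2)) + 2 * (C * Real.exp (-(β / 8) * ‖v'‖ ^ 2)) := by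
            gcongr
        _ = 4 * C * Real.exp (-(β / 8) * ‖v'‖ ^ 2) := by ring
    · refine Eventually.of_forall fun v' => ?_
      have hc : Continuous fun v => F v v' := by
        simp only [hF]
        have h1 : Continuous fun v : EuclideanSpace ℝ d => regKernelFun δ β v v' :=
          (continuous_regKernelFun_uncurry hd hβ hδ).comp
            (f := fun v : EuclideanSpace ℝ d => (v, v')) (continuous_id.prodMk continuous_const)
        exact ((h1.sub continuous_const).pow 2).mul continuous_const
      have h0 : F v₀ v' = 0 := by simp [hF]
      simpa [h0] using hc.tendsto v₀
  rw [integral_zero] at hlim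
  have hsqrt := hlim.sqrt
  rw [Real.sqrt_zero] at hsqrt
  refine hsqrt.congr fun v => ?_
  simp only [hF]
  rw [← norm_regKernelLp_sub_sq hd hβ hδ v v₀, Real.sqrt_sq (norm_nonneg _)]

end RegularLp

/-! ## `T_reg` acts through the regular kernel; compactness -/

section Compact

variable (hd : 2 ≤ Fintype.card d) (hβ : 0 < β) {δ : ℝ} (hδ : 0 < δ)

/-- **The inner products against the regular kernel**:
`⟪κ_v, g⟫_{L²(aM)} = a_β(v)⁻¹ ∫ θ_δ(u) k_β(v, u) g(v + u) du`. [folklore] -/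
theorem inner_regKernelLp (v : EuclideanSpace ℝ d) (g : Lp ℝ 2 (energyMeasure (d := d) β)) :
    ⟪regKernelLp hd hβ hδ v, g⟫_ℝ =
      (collisionFrequency β v)⁻¹ * ∫ u, bump δ u * carlemanKernel β v u * rep g (v + u) := by
  obtain ⟨a₀, ha₀, c, hc, hlow⟩ := exists_collisionFrequency_lowerBound (d := d) hd hβ
  have ha : ∀ w : EuclideanSpace ℝ d, collisionFrequency β w ≠ 0 := fun w => (ha₀.trans_le (hlow w).1).ne'
  rw [inner_eq_integral_rep hβ]
  have h1 : ∫ v', rep (regKernelLp hd hβ hδ v) v' * rep g v' * (collisionFrequency β v' * maxwellianBeta β v') =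
      ∫ v', (collisionFrequency β v)⁻¹ * (bump δ (v' - v) * carlemanKernel β v (v' - v) * rep g v') := by
    refine integral_congr_ae ?_
    filter_upwards [rep_toLp_ae_eq hd hβ (memLp_regKernelFun hd hβ hδ v)] with v' hv'
    have hv'' : rep (regKernelLp hd hβ hδ v) v' = regKernelFun δ β v v' := hv'
    rw [hv'']
    simp only [regKernelFun, regKernel]
    have h2 : maxwellianBeta β v' ≠ 0 := (maxwellianBeta_pos hβ v').ne'
    field_simp [ha v, ha v', h2]
  rw [h1, integral_const_mul]
  congr 1
  rw [← integral_add_right_eq_self (μ := (volume : Measure (EuclideanSpace ℝ d)))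
    (fun v' => bump δ (v' - v) * carlemanKernel β v (v' - v) * rep g v') v]
  refine integral_congr_ae (Eventually.of_forall fun u => ?_)
  simp only [add_comm u v, add_sub_cancel_left]

/-- The function `v ↦ 1_{|v| ≤ R} ⟪κ_v, g⟫` is in `L²(a_β M_β)` (bounded with compact support).
[folklore] -/
theorem memLp_indicator_inner_regKernelLp (R : ℝ) (g : Lp ℝ 2 (energyMeasure (d := d) β)) :
    MemLp ((closedBall (0 : EuclideanSpace ℝ d) R).indicator fun v => ⟪regKernelLp hd hβ hδ v, g⟫_ℝ) 2
      (energyMeasure β) := by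
  haveI := isFiniteMeasure_energyMeasure (d := d) hβ
  have hcont : Continuous fun v => ⟪regKernelLp hd hβ hδ v, g⟫_ℝ :=
    (continuous_regKernelLp hd hβ hδ).inner continuous_const
  obtain ⟨B, hB⟩ := (isCompact_closedBall (0 : EuclideanSpace ℝ d) R).exists_bound_of_continuousOn
    (continuous_regKernelLp hd hβ hδ).continuousOn
  refine MemLp.of_bound (hcont.aestronglyMeasurable.indicator measurableSet_closedBall) (max B 0 * ‖g‖)
    (Eventually.of_forall fun v => ?_)
  by_cases hv : v ∈ closedBall (0 : EuclideanSpace ℝ d) R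
  · rw [indicator_of_mem hv, Real.norm_eq_abs]
    exact (abs_real_inner_le_norm _ _).trans (mul_le_mul_of_nonneg_right ((hB v hv).trans
      (le_max_left _ _)) (norm_nonneg _))
  · rw [indicator_of_notMem hv, norm_zero]
    exact mul_nonneg (le_max_right _ _) (norm_nonneg _)

/-- **`T_reg` acts through the regular kernel**: `(T_reg g)(v) = 1_{|v| ≤ R} ⟪κ_v, g⟫` a.e.
(Fubini on `Q_reg`, and the translation `v' = v + u`). [folklore] -/
theorem truncOp_cutReg_ae_eq (R : ℝ) (D : CutoffData β (cutReg (d := d) δ R))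
    (g : Lp ℝ 2 (energyMeasure (d := d) β)) :
    (truncOp hd hβ D g : EuclideanSpace ℝ d → ℝ) =ᵐ[energyMeasure β]
      (closedBall (0 : EuclideanSpace ℝ d) R).indicator fun v => ⟪regKernelLp hd hβ hδ v, g⟫_ℝ := by
  obtain ⟨a₀, ha₀, c, hc, hlow⟩ := exists_collisionFrequency_lowerBound (d := d) hd hβ
  have ha : ∀ w : EuclideanSpace ℝ d, collisionFrequency β w ≠ 0 := fun w => (ha₀.trans_le (hlow w).1).ne'
  have hΦ := memLp_indicator_inner_regKernelLp hd hβ hδ R g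
  suffices heq : truncOp hd hβ D g = hΦ.toLp _ by
    rw [heq]; exact hΦ.coeFn_toLp
  refine ext_inner_right ℝ fun h => ?_
  have hg := finiteEnergy_rep hβ g
  have hh := finiteEnergy_rep hβ h
  -- left-hand side: Fubini
  rw [inner_truncOp, truncForm, integral_prod _ (integrable_truncForm_integrand hd hβ D.isCutoff hg hh)]
  -- right-hand side
  rw [inner_eq_integral_rep hβ]
  have hR : ∫ v, rep (hΦ.toLp _) v * rep h v * (collisionFrequency β v * maxwellianBeta β v) =
      ∫ v, ballCut R v * rep h v * maxwellianBeta β v *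
        ∫ u, bump δ u * carlemanKernel β v u * rep g (v + u) := by
    refine integral_congr_ae ?_
    filter_upwards [rep_toLp_ae_eq hd hβ hΦ] with v hv
    rw [hv]
    by_cases hvR : v ∈ closedBall (0 : EuclideanSpace ℝ d) R
    · have hb : ballCut R v = 1 := by rw [ballCut_eq_indicator, indicator_of_mem hvR]
      rw [indicator_of_mem hvR, inner_regKernelLp hd hβ hδ, hb]
      field_simp [ha v]
    · have hb : ballCut R v = 0 := by rw [ballCut_eq_indicator, indicator_of_notMem hvR]
      rw [indicator_of_notMem hvR, hb]
      simp
  rw [hR]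
  refine integral_congr_ae (Eventually.of_forall fun v => ?_)
  simp only
  rw [← integral_const_mul]
  refine integral_congr_ae (Eventually.of_forall fun u => ?_)
  simp only [cutReg]
  ring

include hδ in
/-- **The regular part `T_reg` is a compact operator** (continuous kernel on a compact set:
`ContinuousKernelCompactOperator`). [folklore] -/
theorem isCompactOperator_truncOp_cutReg {R : ℝ} (D : CutoffData β (cutReg (d := d) δ R)) :
    IsCompactOperator (truncOp hd hβ D) := by
  haveI := isFiniteMeasure_energyMeasure (d := d) hβ
  exact Literature.Analysis.FunctionSpaces.isCompactOperator_of_ae_eq_indicator_inner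
    (isCompact_closedBall (0 : EuclideanSpace ℝ d) R) (regKernelLp hd hβ hδ)
    (continuous_regKernelLp hd hβ hδ).continuousOn (truncOp hd hβ D) (truncOp_cutReg_ae_eq hd hβ hδ R D)

/-- **BGSR Lemma 6.1, compactness half: the gain operator `T = a_β⁻¹ K` is compact on
`L²(a_β M_β)`** (`L = a_β (Id - T)` with `K` compact, "as in Hilbert [24]"). Proof: for
`δ = (n+1)⁻¹`, `R = n + 1`, `‖T - T_reg‖ ≤ ‖T_near‖ + ‖T_tail‖ ≤ a₀⁻¹ ∫_{|u|<δ} G_β +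
√((I_β/a₀) · I_β/√(a₀ c R)) → 0`, each `T_reg` is compact, and norm limits of compact operators
are compact (CIP Thm 7.2.4 for the linearized operator).
[cite: BodineauGallagherSaintRaymondInvent2016, Lemma 6.1] -/
theorem isCompactOperator_gainOp : IsCompactOperator (gainOp hd hβ) := by
  obtain ⟨a₀, ha₀, c, hc, hlow⟩ := exists_collisionFrequency_lowerBound (d := d) hd hβ
  have hlow1 : ∀ w : EuclideanSpace ℝ d, a₀ ≤ collisionFrequency β w := fun w => (hlow w).1
  have hlow2 : ∀ w : EuclideanSpace ℝ d, c * ‖w‖ ≤ collisionFrequency β w := fun w => (hlow w).2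
  set I : ℝ := ∫ u : EuclideanSpace ℝ d, gradRadial β u with hI
  have hI0 : 0 ≤ I := integral_gradRadial_nonneg β
  set ε : ℕ → ℝ := fun n => (∫ u in ball (0 : EuclideanSpace ℝ d) (((n : ℝ) + 1)⁻¹), gradRadial β u) / a₀ with hε
  set τ : ℕ → ℝ := fun n => I / Real.sqrt (a₀ * (c * ((n : ℝ) + 1))) with hτ
  have hε0 : ∀ n, 0 ≤ ε n := fun n => div_nonneg (setIntegral_nonneg measurableSet_ball
    fun u _ => gradRadial_nonneg β u) ha₀.le
  have hτ0 : ∀ n, 0 ≤ τ n := fun n => div_nonneg hI0 (Real.sqrt_nonneg _)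
  have hρ1 : 0 ≤ I / a₀ := div_nonneg hI0 ha₀.le
  -- cut-off data along the sequence
  let Dreg : ∀ n : ℕ, CutoffData β (cutReg (d := d) (((n : ℝ) + 1)⁻¹) ((n : ℝ) + 1)) := fun n =>
    { isCutoff := isCutoff_cutReg _ _
      ρ := I / a₀
      ρ' := I / a₀
      ρ_nonneg := hρ1
      ρ'_nonneg := hρ1
      row := rowBound_of_le_one hd hβ ha₀ hlow1 (isCutoff_cutReg _ _).le_one
      row' := rowBound_of_le_one hd hβ ha₀ hlow1 (reflectCutoff_cutReg_le_one _ _) }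
  let Dnear : ∀ n : ℕ, CutoffData β (cutNear (d := d) (((n : ℝ) + 1)⁻¹) ((n : ℝ) + 1)) := fun n =>
    { isCutoff := isCutoff_cutNear _ _
      ρ := ε n
      ρ' := ε n
      ρ_nonneg := hε0 n
      ρ'_nonneg := hε0 n
      row := rowBound_of_le_indicator_ball hd hβ ha₀ hlow1
        (cutNear_le_indicator (by positivity) _)
      row' := rowBound_of_le_indicator_ball hd hβ ha₀ hlow1
        (reflectCutoff_cutNear_le_indicator (by positivity) _) }
  let Dtail : ∀ n : ℕ, CutoffData β (cutTail (d := d) ((n : ℝ) + 1)) := fun n =>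
    { isCutoff := isCutoff_cutTail _
      ρ := τ n
      ρ' := I / a₀
      ρ_nonneg := hτ0 n
      ρ'_nonneg := hρ1
      row := rowBound_of_le_indicator_norm_gt hd hβ ha₀ hlow1 hc hlow2 (by positivity)
        (isCutoff_cutTail _).nonneg (cutTail_le _)
      row' := rowBound_of_le_one hd hβ ha₀ hlow1 (reflectCutoff_cutTail_le_one _) }
  -- the compact approximants and the error bound
  set S : ℕ → Lp ℝ 2 (energyMeasure (d := d) β) →L[ℝ] Lp ℝ 2 (energyMeasure (d := d) β) :=
    fun n => truncOp hd hβ (Dreg n) with hS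
  have hScomp : ∀ n, IsCompactOperator (S n) := fun n =>
    isCompactOperator_truncOp_cutReg hd hβ (by positivity) (Dreg n)
  have herr : ∀ n, ‖gainOp hd hβ - S n‖ ≤ ε n + Real.sqrt (I / a₀ * τ n) := by
    intro n
    rw [gainOp_eq_add hd hβ (Dreg n) (Dnear n) (Dtail n), hS]
    simp only
    rw [show truncOp hd hβ (Dreg n) + truncOp hd hβ (Dnear n) + truncOp hd hβ (Dtail n) -
        truncOp hd hβ (Dreg n) = truncOp hd hβ (Dnear n) + truncOp hd hβ (Dtail n) by abel]
    refine (norm_add_le _ _).trans (add_le_add ?_ ?_)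
    · have h : ‖truncOp hd hβ (Dnear n)‖ ≤ Real.sqrt (ε n * ε n) := norm_truncOp_le hd hβ (Dnear n)
      rwa [Real.sqrt_mul_self (hε0 n)] at h
    · have h : ‖truncOp hd hβ (Dtail n)‖ ≤ Real.sqrt (I / a₀ * τ n) := norm_truncOp_le hd hβ (Dtail n)
      exact h
  -- the error bound tends to zero
  have hεlim : Tendsto ε atTop (𝓝 0) := by
    have h := (tendsto_setIntegral_gradRadial hd hβ).div_const a₀
    rw [zero_div] at h
    exact h
  have hτlim : Tendsto τ atTop (𝓝 0) := by
    have h1 : Tendsto (fun n : ℕ => a₀ * (c * ((n : ℝ) + 1))) atTop atTop := by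
      refine Tendsto.const_mul_atTop ha₀ (Tendsto.const_mul_atTop hc ?_)
      exact tendsto_atTop_add_const_right _ 1 tendsto_natCast_atTop_atTop
    have h2 := (tendsto_rpow_atTop (by norm_num : (0 : ℝ) < 1 / 2)).comp h1
    have h3 : Tendsto (fun n : ℕ => Real.sqrt (a₀ * (c * ((n : ℝ) + 1)))) atTop atTop := by
      refine h2.congr fun n => ?_
      simp [Function.comp, Real.sqrt_eq_rpow]
    exact tendsto_const_nhds.div_atTop h3
  have hlim : Tendsto (fun n => ε n + Real.sqrt (I / a₀ * τ n)) atTop (𝓝 0) := by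
    have h := hεlim.add ((hτlim.const_mul (I / a₀)).sqrt)
    rw [mul_zero, Real.sqrt_zero, add_zero] at h
    exact h
  refine isCompactOperator_of_tendsto (l := atTop) (F := S) ?_ (Eventually.of_forall hScomp)
  rw [tendsto_iff_norm_sub_tendsto_zero]
  refine squeeze_zero (fun n => norm_nonneg _) (fun n => ?_) hlim
  rw [norm_sub_rev]
  exact herr n

end Compact

end Literature.MathematicalPhysics.KineticTheory
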